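import Mathlib
import Literature.Analysis.ODE.DissipativeTailIsolation
import Literature.Analysis.ODE.GeometricDecayConvolution
import HarnessLib

/-!
# Uniform far-tail enclosure for dissipative mode systems with geometric decay
# (Wilczak–Zgliczyński 2020, §4.3 Lemma 18)

Setting of [WilczakZgliczynski2020, §3–§4]: a dissipative PDE written in (Fourier) modes
`a_k' = -L_k a_k + N_k(a)` under the standing assumptions C1 (`L_* k^p ≤ L_k`, `p > 1`) and
C2 (`|N_k(a)| ≤ D k^r q^{-k}` on the self-consistent set `W_{q,S}`, `r ≤ p`), and sets of the form
`GBound(m, ã, S, q) = {a : a_k ∈ ã_k (k ≤ m), |a_k| ≤ S q^{-k} (k > m)}`.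

Once a rough enclosure `E = GBound(m, ã_E, S_E, q)` of the solutions over a time step `[0, h]` is
known, every far mode `k > m` obeys the scalar linear differential inequality
`|a_k' + L_k a_k| ≤ D k^r q^{-k}` on `[0, h]`, and the one-mode estimate
(`abs_le_of_dissipativeMode`, file `DissipativeTailIsolation`) gives
`|a_k(t)| ≤ |a_k(0)| e^{-L_k t} + (D k^r q^{-k} / L_k)(1 - e^{-L_k t})`.  The point of
[WilczakZgliczynski2020, Lemma 18] is that this bound is UNIFORM in `k` after multiplication by the
weight `q^k`: using `L_k ≥ L_* k^p ≥ L_* (m+1)^p` and `k^r / k^p ≤ (m+1)^{-(p-r)}` for `k ≥ m + 1`,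

  `q^k |a_k(t)| ≤ D / (L_* (m+1)^{p-r}) + S e^{-L_* (m+1)^p t}`      (`|a_k(0)| ≤ S q^{-k}`),

so the whole infinite far tail at time `t` is again a `GBound` with the SAME decay rate `q` and an
explicitly computable constant — one formula for infinitely many modes.  (The paper states the
end-point version `t = h` with `S = S_E` and takes the minimum with the trivial bound `S_E` coming from
`a(h) ∈ E`; the sup-over-`[0,h]` version `q^k |a_k(t)| ≤ max (S, D/(L_*(m+1)^{p-r}))` is the far-tail
part of the isolation / "vector field pointing inwards" check of §4.4.2 step 5.)

This file proves:

* `abs_le_weighted_of_dissipativeMode`, `abs_le_weighted_max_of_dissipativeMode` — the weighted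
  one-mode form behind the uniformisation: if `0 < λ₀ ≤ λ`, `|u(a)| ≤ w S` and `F/λ ≤ w Φ` then
  `|u(t)| ≤ w (S e^{-λ₀ (t-a)} + Φ)` and `|u(t)| ≤ w · max S Φ` on `[a, b]`;
* `geometricTail_le_of_powerLaws`, `geometricTail_le_max_of_powerLaws` — Lemma 18 as stated in the
  paper's abstract setting (constants `L_*, p, D, r, q`, far modes `k ≥ m + 1`);
* `ks_farMode_weighted_le`, `ks_farMode_weighted_le_max`, `ks_farMode_le_div` — the
  Kuramoto–Sivashinsky instance [WilczakZgliczynski2020, §5.1]: `L_k = ν k⁴ - k²`, far modes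
  `k ≥ K` with `ν K² > 1`, and the sharper forcing bound `|N_k| ≤ q^{-k} k (c₁ + c₂ k)` of
  §5.2 Lemma 21 (file `GeometricDecayConvolution`, `ks_quadratic_le_of_gbound'`), for which the
  uniform constant is `FAR = (c₁/K + c₂)/(ν K² - 1)` (`far_weighted_le`):
  `q^k |a_k(t)| ≤ S e^{-(ν K⁴ - K²)(t - a)} + FAR` and `q^k |a_k(t)| ≤ max S FAR`.

All statements are about one real mode `u = a_k` (or `u = q^k`-weighted data) satisfying a
differential inequality with a right derivative on `[a, b)`; no finiteness or summability enters,
which is exactly why the bound serves infinitely many modes at once.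
-/

open Set Real

namespace Literature.Analysis.ODE

/-! ## The weighted one-mode estimate -/

/-- **Weighted dissipative mode, exponential form** [cite: WilczakZgliczynski2020, §4.3, proof of
Lemma 18].  Let `u` be continuous on `[a, b]` with right derivative `u'` on `[a, b)` and
`|u' + λ u| ≤ F` there, `0 < λ₀ ≤ λ`.  If `|u(a)| ≤ w S` and `F / λ ≤ w Φ` with `w, Φ ≥ 0`, then
`|u(t)| ≤ w (S e^{-λ₀ (t - a)} + Φ)` for `t ∈ [a, b]`.  (With `w = q^{-k}`, `λ₀ = L_* (m+1)^p` this is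
uniform in the mode index.) -/
theorem abs_le_weighted_of_dissipativeMode {u u' : ℝ → ℝ} {a b lam lam₀ F w S Φ : ℝ}
    (hu : ContinuousOn u (Icc a b)) (hu' : ∀ t ∈ Ico a b, HasDerivWithinAt u (u' t) (Ici t) t)
    (hlam₀ : 0 < lam₀) (hlam : lam₀ ≤ lam) (bound : ∀ t ∈ Ico a b, |u' t + lam * u t| ≤ F)
    (hw : 0 ≤ w) (hΦ : 0 ≤ Φ) (h0 : |u a| ≤ w * S) (hF : F / lam ≤ w * Φ) {t : ℝ}
    (ht : t ∈ Icc a b) : |u t| ≤ w * (S * exp (-lam₀ * (t - a)) + Φ) := by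
  have hlam' : 0 < lam := lt_of_lt_of_le hlam₀ hlam
  have h := abs_le_of_dissipativeMode hu hu' hlam' bound ht
  have hta : 0 ≤ t - a := by linarith [ht.1]
  set E := exp (-lam * (t - a)) with hE
  set E₀ := exp (-lam₀ * (t - a)) with hE₀
  have hEpos : 0 < E := exp_pos _
  have hE1 : E ≤ 1 := by
    rw [hE]; apply exp_le_one_iff.mpr; nlinarith
  have hEE₀ : E ≤ E₀ := by
    rw [hE, hE₀]; apply exp_le_exp.mpr; nlinarith
  have hwS : 0 ≤ w * S := le_trans (abs_nonneg _) h0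
  have h1 : |u a| * E ≤ w * S * E₀ :=
    calc |u a| * E ≤ w * S * E := mul_le_mul_of_nonneg_right h0 hEpos.le
      _ ≤ w * S * E₀ := mul_le_mul_of_nonneg_left hEE₀ hwS
  have h2 : F / lam * (1 - E) ≤ w * Φ := by
    calc F / lam * (1 - E) ≤ w * Φ * (1 - E) :=
          mul_le_mul_of_nonneg_right hF (by linarith)
      _ ≤ w * Φ * 1 := mul_le_mul_of_nonneg_left (by linarith) (mul_nonneg hw hΦ)
      _ = w * Φ := mul_one _
  calc |u t| ≤ |u a| * E + F / lam * (1 - E) := h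
    _ ≤ w * S * E₀ + w * Φ := add_le_add h1 h2
    _ = w * (S * E₀ + Φ) := by ring

/-- **Weighted dissipative mode, `max` form** [cite: WilczakZgliczynski2020, §4.3 Lemma 18 with
§4.4.2 step 5 (far-tail isolation)].  Under the hypotheses of `abs_le_of_dissipativeMode`, if
`|u(a)| ≤ w S` and `F/λ ≤ w Φ` with `w ≥ 0` then `|u(t)| ≤ w · max S Φ` on `[a, b]`. -/
theorem abs_le_weighted_max_of_dissipativeMode {u u' : ℝ → ℝ} {a b lam F w S Φ : ℝ}
    (hu : ContinuousOn u (Icc a b)) (hu' : ∀ t ∈ Ico a b, HasDerivWithinAt u (u' t) (Ici t) t)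
    (hlam : 0 < lam) (bound : ∀ t ∈ Ico a b, |u' t + lam * u t| ≤ F)
    (hw : 0 ≤ w) (h0 : |u a| ≤ w * S) (hF : F / lam ≤ w * Φ) {t : ℝ} (ht : t ∈ Icc a b) :
    |u t| ≤ w * max S Φ := by
  have h := abs_le_max_of_dissipativeMode hu hu' hlam bound ht
  refine h.trans (max_le ?_ ?_)
  · exact h0.trans (mul_le_mul_of_nonneg_left (le_max_left _ _) hw)
  · exact hF.trans (mul_le_mul_of_nonneg_left (le_max_right _ _) hw)

/-! ## Lemma 18 in the abstract setting C1–C2 -/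

/-- The uniformisation of the forcing-to-damping ratio [cite: WilczakZgliczynski2020, §4.3, display
before Lemma 18]: if `0 < L_*`, `L_* k^p ≤ L`, `0 ≤ F ≤ D k^r q^{-k}`-type bound with `D ≥ 0`,
`r ≤ p` and `m + 1 ≤ k`, then `F / L ≤ q^{-k} · D / (L_* (m+1)^{p-r})`. -/
theorem forcing_div_le_of_powerLaws {Lstar p r D q L F : ℝ} {m k : ℕ} (hLstar : 0 < Lstar)
    (hrp : r ≤ p) (hD : 0 ≤ D) (hq : 0 < q) (hk : m + 1 ≤ k)
    (hL : Lstar * (k : ℝ) ^ p ≤ L) (hF : F ≤ D * (k : ℝ) ^ r * (q ^ k)⁻¹) :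
    F / L ≤ (q ^ k)⁻¹ * (D / (Lstar * ((m + 1 : ℕ) : ℝ) ^ (p - r))) := by
  have hk0 : (0 : ℝ) < k := by exact_mod_cast (show 0 < k by omega)
  have hm0 : (0 : ℝ) < ((m + 1 : ℕ) : ℝ) := by exact_mod_cast (show 0 < m + 1 by omega)
  have hmk : ((m + 1 : ℕ) : ℝ) ≤ (k : ℝ) := by exact_mod_cast hk
  have hkp : 0 < (k : ℝ) ^ p := rpow_pos_of_pos hk0 _
  have hLk : 0 < Lstar * (k : ℝ) ^ p := mul_pos hLstar hkp
  have hLpos : 0 < L := lt_of_lt_of_le hLk hL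
  have hqk : 0 < (q ^ k)⁻¹ := inv_pos.mpr (pow_pos hq _)
  have hN : 0 ≤ D * (k : ℝ) ^ r * (q ^ k)⁻¹ :=
    mul_nonneg (mul_nonneg hD (rpow_nonneg hk0.le _)) hqk.le
  -- F/L ≤ N/L ≤ N/(L_* k^p)
  have h1 : F / L ≤ D * (k : ℝ) ^ r * (q ^ k)⁻¹ / (Lstar * (k : ℝ) ^ p) :=
    calc F / L ≤ D * (k : ℝ) ^ r * (q ^ k)⁻¹ / L := div_le_div_of_nonneg_right hF hLpos.le
      _ ≤ D * (k : ℝ) ^ r * (q ^ k)⁻¹ / (Lstar * (k : ℝ) ^ p) :=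
          div_le_div_of_nonneg_left hN hLk hL
  -- k^p = k^(p-r) * k^r
  have hsplit : (k : ℝ) ^ p = (k : ℝ) ^ (p - r) * (k : ℝ) ^ r := by
    rw [← rpow_add hk0]; congr 1; ring
  have hkpr : 0 < (k : ℝ) ^ (p - r) := rpow_pos_of_pos hk0 _
  have hkr : 0 < (k : ℝ) ^ r := rpow_pos_of_pos hk0 _
  have h2 : D * (k : ℝ) ^ r * (q ^ k)⁻¹ / (Lstar * (k : ℝ) ^ p)
      = (q ^ k)⁻¹ * (D / (Lstar * (k : ℝ) ^ (p - r))) := by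
    rw [hsplit]; field_simp
  -- (m+1)^(p-r) ≤ k^(p-r)
  have hmono : ((m + 1 : ℕ) : ℝ) ^ (p - r) ≤ (k : ℝ) ^ (p - r) :=
    rpow_le_rpow hm0.le hmk (by linarith)
  have hmpr : 0 < ((m + 1 : ℕ) : ℝ) ^ (p - r) := rpow_pos_of_pos hm0 _
  have h3 : D / (Lstar * (k : ℝ) ^ (p - r)) ≤ D / (Lstar * ((m + 1 : ℕ) : ℝ) ^ (p - r)) :=
    div_le_div_of_nonneg_left hD (mul_pos hLstar hmpr) (mul_le_mul_of_nonneg_left hmono hLstar.le)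
  calc F / L ≤ D * (k : ℝ) ^ r * (q ^ k)⁻¹ / (Lstar * (k : ℝ) ^ p) := h1
    _ = (q ^ k)⁻¹ * (D / (Lstar * (k : ℝ) ^ (p - r))) := h2
    _ ≤ (q ^ k)⁻¹ * (D / (Lstar * ((m + 1 : ℕ) : ℝ) ^ (p - r))) :=
        mul_le_mul_of_nonneg_left h3 hqk.le

/-- **Lemma 18 of Wilczak–Zgliczyński (uniform far-tail bound, exponential form)**
[cite: WilczakZgliczynski2020, §4.3 Lemma 18].  Abstract setting C1–C2: `0 < L_*`, `0 ≤ p`,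
`r ≤ p`, `D ≥ 0`, `q > 0`.  Let `k ≥ m + 1` be a far mode with damping `L ≥ L_* k^p`, and let
`u = a_k` be continuous on `[a, b]` with right derivative `u'` and `|u' + L u| ≤ F ≤ D k^r q^{-k}` on
`[a, b)`, `|u(a)| ≤ S q^{-k}`.  Then for `t ∈ [a, b]`

  `|u(t)| ≤ q^{-k} ( D / (L_* (m+1)^{p-r}) + S e^{-L_* (m+1)^p (t - a)} )`,

a bound whose bracket does not depend on `k`: the far tail stays a `GBound` with the same `q`. -/
theorem geometricTail_le_of_powerLaws {u u' : ℝ → ℝ} {a b Lstar p r D q L F S : ℝ} {m k : ℕ}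
    (hu : ContinuousOn u (Icc a b)) (hu' : ∀ t ∈ Ico a b, HasDerivWithinAt u (u' t) (Ici t) t)
    (hLstar : 0 < Lstar) (hp : 0 ≤ p) (hrp : r ≤ p) (hD : 0 ≤ D) (hq : 0 < q) (hk : m + 1 ≤ k)
    (hL : Lstar * (k : ℝ) ^ p ≤ L) (bound : ∀ t ∈ Ico a b, |u' t + L * u t| ≤ F)
    (hF : F ≤ D * (k : ℝ) ^ r * (q ^ k)⁻¹) (h0 : |u a| ≤ S * (q ^ k)⁻¹) {t : ℝ} (ht : t ∈ Icc a b) :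
    |u t| ≤ (q ^ k)⁻¹ * (D / (Lstar * ((m + 1 : ℕ) : ℝ) ^ (p - r))
      + S * exp (-(Lstar * ((m + 1 : ℕ) : ℝ) ^ p) * (t - a))) := by
  have hk0 : (0 : ℝ) < k := by exact_mod_cast (show 0 < k by omega)
  have hm0 : (0 : ℝ) < ((m + 1 : ℕ) : ℝ) := by exact_mod_cast (show 0 < m + 1 by omega)
  have hmk : ((m + 1 : ℕ) : ℝ) ≤ (k : ℝ) := by exact_mod_cast hk
  have hlam₀ : 0 < Lstar * ((m + 1 : ℕ) : ℝ) ^ p := mul_pos hLstar (rpow_pos_of_pos hm0 _)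
  have hlam : Lstar * ((m + 1 : ℕ) : ℝ) ^ p ≤ L :=
    le_trans (mul_le_mul_of_nonneg_left (rpow_le_rpow hm0.le hmk hp) hLstar.le) hL
  have hqk : 0 ≤ (q ^ k)⁻¹ := (inv_pos.mpr (pow_pos hq _)).le
  have hΦ : 0 ≤ D / (Lstar * ((m + 1 : ℕ) : ℝ) ^ (p - r)) :=
    div_nonneg hD (mul_nonneg hLstar.le (rpow_nonneg hm0.le _))
  have hFL := forcing_div_le_of_powerLaws hLstar hrp hD hq hk hL hF
  have h0' : |u a| ≤ (q ^ k)⁻¹ * S := by rw [mul_comm]; exact h0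
  have h := abs_le_weighted_of_dissipativeMode hu hu' hlam₀ hlam bound hqk hΦ h0' hFL ht
  calc |u t| ≤ (q ^ k)⁻¹ * (S * exp (-(Lstar * ((m + 1 : ℕ) : ℝ) ^ p) * (t - a))
        + D / (Lstar * ((m + 1 : ℕ) : ℝ) ^ (p - r))) := h
    _ = _ := by ring

/-- **Lemma 18, `max` (isolation) form** [cite: WilczakZgliczynski2020, §4.3 Lemma 18; §4.4.2
step 5].  Under the hypotheses of `geometricTail_le_of_powerLaws` (the monotonicity data `0 ≤ p` is
not needed here), `|u(t)| ≤ q^{-k} · max (S, D / (L_* (m+1)^{p-r}))` on `[a, b]`. -/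
theorem geometricTail_le_max_of_powerLaws {u u' : ℝ → ℝ} {a b Lstar p r D q L F S : ℝ} {m k : ℕ}
    (hu : ContinuousOn u (Icc a b)) (hu' : ∀ t ∈ Ico a b, HasDerivWithinAt u (u' t) (Ici t) t)
    (hLstar : 0 < Lstar) (hrp : r ≤ p) (hD : 0 ≤ D) (hq : 0 < q) (hk : m + 1 ≤ k)
    (hL : Lstar * (k : ℝ) ^ p ≤ L) (bound : ∀ t ∈ Ico a b, |u' t + L * u t| ≤ F)
    (hF : F ≤ D * (k : ℝ) ^ r * (q ^ k)⁻¹) (h0 : |u a| ≤ S * (q ^ k)⁻¹) {t : ℝ} (ht : t ∈ Icc a b) :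
    |u t| ≤ (q ^ k)⁻¹ * max S (D / (Lstar * ((m + 1 : ℕ) : ℝ) ^ (p - r))) := by
  have hk0 : (0 : ℝ) < k := by exact_mod_cast (show 0 < k by omega)
  have hLpos : 0 < L := lt_of_lt_of_le (mul_pos hLstar (rpow_pos_of_pos hk0 _)) hL
  have hqk : 0 ≤ (q ^ k)⁻¹ := (inv_pos.mpr (pow_pos hq _)).le
  have hFL := forcing_div_le_of_powerLaws hLstar hrp hD hq hk hL hF
  have h0' : |u a| ≤ (q ^ k)⁻¹ * S := by rw [mul_comm]; exact h0
  exact abs_le_weighted_max_of_dissipativeMode hu hu' hLpos bound hqk h0' hFL ht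

/-! ## The Kuramoto–Sivashinsky instance -/

/-- Monotonicity of the KS damping `ν k⁴ - k²` on the far modes (non-strict form of `ks_eigen_lt`)
[cite: WilczakZgliczynski2020, §5.1 (C1 for KS)]. -/
theorem ks_eigen_le {ν : ℝ} (hν : 0 < ν) {K k k' : ℕ} (hK : 1 < ν * (K : ℝ) ^ 2) (hk : K ≤ k)
    (hkk' : k ≤ k') : ν * (k : ℝ) ^ 4 - (k : ℝ) ^ 2 ≤ ν * (k' : ℝ) ^ 4 - (k' : ℝ) ^ 2 := by
  rcases Nat.lt_or_ge k k' with h | h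
  · exact (ks_eigen_lt hν hK hk h).le
  · have : k = k' := le_antisymm hkk' h
    subst this; exact le_rfl

/-- The uniform far constant is nonnegative: `0 ≤ FAR = (c₁/K + c₂)/(ν K² - 1)` for `c₁, c₂ ≥ 0`,
`ν K² > 1` [cite: WilczakZgliczynski2020, §5.2 Lemma 21 with §4.3 Lemma 18]. -/
theorem far_nonneg {ν c₁ c₂ : ℝ} (hc₁ : 0 ≤ c₁) (hc₂ : 0 ≤ c₂) {K : ℕ}
    (hK : 1 < ν * (K : ℝ) ^ 2) : 0 ≤ (c₁ / K + c₂) / (ν * (K : ℝ) ^ 2 - 1) :=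
  div_nonneg (add_nonneg (div_nonneg hc₁ (Nat.cast_nonneg _)) hc₂) (by linarith)

/-- **Uniform far-tail bound for Kuramoto–Sivashinsky, exponential form**
[cite: WilczakZgliczynski2020, §4.3 Lemma 18 with §5.1–§5.2 (Lemma 21)].  KS in modes:
`a_k' = -(ν k⁴ - k²) a_k + N_k(a)`.  Let `K` be a far threshold with `ν K² > 1` and `k ≥ K`; let
`u = a_k` be continuous on `[a, b]` with right derivative `u'`, `|u' + (ν k⁴ - k²) u| ≤ F` on `[a, b)`
where the forcing obeys the geometric-decay estimate `F ≤ q^{-k} k (c₁ + c₂ k)` (`c₁, c₂ ≥ 0`, `q > 0`;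
this is the shape delivered by `ks_quadratic_le_of_gbound'`), and `|u(a)| ≤ S / q^k`.  Then for
`t ∈ [a, b]`

  `q^k |u(t)| ≤ S e^{-(ν K⁴ - K²)(t - a)} + FAR`,   `FAR = (c₁/K + c₂)/(ν K² - 1)`,

uniformly in `k ≥ K` (`far_weighted_le` supplies `q^k F/(ν k⁴ - k²) ≤ FAR`, `ks_eigen_le` the
slowest far decay rate). -/
theorem ks_farMode_weighted_le {u u' : ℝ → ℝ} {a b ν q c₁ c₂ F S : ℝ} {K k : ℕ}
    (hu : ContinuousOn u (Icc a b)) (hu' : ∀ t ∈ Ico a b, HasDerivWithinAt u (u' t) (Ici t) t)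
    (hν : 0 < ν) (hq : 0 < q) (hc₁ : 0 ≤ c₁) (hc₂ : 0 ≤ c₂) (hK : 1 < ν * (K : ℝ) ^ 2) (hk : K ≤ k)
    (bound : ∀ t ∈ Ico a b, |u' t + (ν * (k : ℝ) ^ 4 - (k : ℝ) ^ 2) * u t| ≤ F)
    (hF : F ≤ (q ^ k)⁻¹ * k * (c₁ + c₂ * k)) (h0 : |u a| ≤ S / q ^ k) {t : ℝ} (ht : t ∈ Icc a b) :
    q ^ k * |u t| ≤ S * exp (-(ν * (K : ℝ) ^ 4 - (K : ℝ) ^ 2) * (t - a))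
      + (c₁ / K + c₂) / (ν * (K : ℝ) ^ 2 - 1) := by
  have hqk : 0 < q ^ k := pow_pos hq _
  have hlam₀ : 0 < ν * (K : ℝ) ^ 4 - (K : ℝ) ^ 2 := ks_eigen_pos hν hK le_rfl
  have hlam : ν * (K : ℝ) ^ 4 - (K : ℝ) ^ 2 ≤ ν * (k : ℝ) ^ 4 - (k : ℝ) ^ 2 :=
    ks_eigen_le hν hK le_rfl hk
  have hlamk : 0 < ν * (k : ℝ) ^ 4 - (k : ℝ) ^ 2 := ks_eigen_pos hν hK hk
  have hΦ := far_nonneg (ν := ν) hc₁ hc₂ hK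
  have hfar := far_weighted_le hν hc₁ hc₂ hq hK hk hF
  -- F/λ_k ≤ q^{-k} FAR
  have hFL : F / (ν * (k : ℝ) ^ 4 - (k : ℝ) ^ 2)
      ≤ (q ^ k)⁻¹ * ((c₁ / K + c₂) / (ν * (K : ℝ) ^ 2 - 1)) := by
    have : F / (ν * (k : ℝ) ^ 4 - (k : ℝ) ^ 2)
        = (q ^ k)⁻¹ * (q ^ k * F / (ν * (k : ℝ) ^ 4 - (k : ℝ) ^ 2)) := by
      field_simp
    rw [this]
    exact mul_le_mul_of_nonneg_left hfar (inv_pos.mpr hqk).le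
  have h0' : |u a| ≤ (q ^ k)⁻¹ * S := by rw [div_eq_inv_mul] at h0; exact h0
  have h := abs_le_weighted_of_dissipativeMode hu hu' hlam₀ hlam bound (inv_pos.mpr hqk).le hΦ
    h0' hFL ht
  have h' : q ^ k * |u t| ≤ q ^ k * ((q ^ k)⁻¹ * (S * exp (-(ν * (K : ℝ) ^ 4 - (K : ℝ) ^ 2)
      * (t - a)) + (c₁ / K + c₂) / (ν * (K : ℝ) ^ 2 - 1))) := mul_le_mul_of_nonneg_left h hqk.le
  calc q ^ k * |u t| ≤ _ := h'
    _ = _ := by field_simp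

/-- **Uniform far-tail bound for KS, `max` (isolation) form** [cite: WilczakZgliczynski2020, §4.3
Lemma 18, §4.4.2 step 5, §5.1–§5.2].  Under the hypotheses of `ks_farMode_weighted_le`,
`q^k |u(t)| ≤ max S FAR` on `[a, b]`, `FAR = (c₁/K + c₂)/(ν K² - 1)`: if `FAR ≤ S` the geometric far
tail `{|a_k| ≤ S q^{-k}, k ≥ K}` is forward invariant for the far modes (self-consistent). -/
theorem ks_farMode_weighted_le_max {u u' : ℝ → ℝ} {a b ν q c₁ c₂ F S : ℝ} {K k : ℕ}
    (hu : ContinuousOn u (Icc a b)) (hu' : ∀ t ∈ Ico a b, HasDerivWithinAt u (u' t) (Ici t) t)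
    (hν : 0 < ν) (hq : 0 < q) (hc₁ : 0 ≤ c₁) (hc₂ : 0 ≤ c₂) (hK : 1 < ν * (K : ℝ) ^ 2) (hk : K ≤ k)
    (bound : ∀ t ∈ Ico a b, |u' t + (ν * (k : ℝ) ^ 4 - (k : ℝ) ^ 2) * u t| ≤ F)
    (hF : F ≤ (q ^ k)⁻¹ * k * (c₁ + c₂ * k)) (h0 : |u a| ≤ S / q ^ k) {t : ℝ} (ht : t ∈ Icc a b) :
    q ^ k * |u t| ≤ max S ((c₁ / K + c₂) / (ν * (K : ℝ) ^ 2 - 1)) := by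
  have hqk : 0 < q ^ k := pow_pos hq _
  have hlamk : 0 < ν * (k : ℝ) ^ 4 - (k : ℝ) ^ 2 := ks_eigen_pos hν hK hk
  have hfar := far_weighted_le hν hc₁ hc₂ hq hK hk hF
  have hFL : F / (ν * (k : ℝ) ^ 4 - (k : ℝ) ^ 2)
      ≤ (q ^ k)⁻¹ * ((c₁ / K + c₂) / (ν * (K : ℝ) ^ 2 - 1)) := by
    have : F / (ν * (k : ℝ) ^ 4 - (k : ℝ) ^ 2)
        = (q ^ k)⁻¹ * (q ^ k * F / (ν * (k : ℝ) ^ 4 - (k : ℝ) ^ 2)) := by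
      field_simp
    rw [this]
    exact mul_le_mul_of_nonneg_left hfar (inv_pos.mpr hqk).le
  have h0' : |u a| ≤ (q ^ k)⁻¹ * S := by rw [div_eq_inv_mul] at h0; exact h0
  have h := abs_le_weighted_max_of_dissipativeMode hu hu' hlamk bound (inv_pos.mpr hqk).le h0' hFL ht
  have h' := mul_le_mul_of_nonneg_left h hqk.le
  calc q ^ k * |u t| ≤ _ := h'
    _ = _ := by field_simp

/-- **The far tail stays a `GBound` with the same `q`** [cite: WilczakZgliczynski2020, §4.3
Lemma 18 (conclusion `|a_k(h)| ≤ S' q^{-k}`), §5.1–§5.2].  Unweighted restatement of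
`ks_farMode_weighted_le`: `|u(t)| ≤ (S e^{-(ν K⁴ - K²)(t-a)} + FAR) / q^k`. -/
theorem ks_farMode_le_div {u u' : ℝ → ℝ} {a b ν q c₁ c₂ F S : ℝ} {K k : ℕ}
    (hu : ContinuousOn u (Icc a b)) (hu' : ∀ t ∈ Ico a b, HasDerivWithinAt u (u' t) (Ici t) t)
    (hν : 0 < ν) (hq : 0 < q) (hc₁ : 0 ≤ c₁) (hc₂ : 0 ≤ c₂) (hK : 1 < ν * (K : ℝ) ^ 2) (hk : K ≤ k)
    (bound : ∀ t ∈ Ico a b, |u' t + (ν * (k : ℝ) ^ 4 - (k : ℝ) ^ 2) * u t| ≤ F)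
    (hF : F ≤ (q ^ k)⁻¹ * k * (c₁ + c₂ * k)) (h0 : |u a| ≤ S / q ^ k) {t : ℝ} (ht : t ∈ Icc a b) :
    |u t| ≤ (S * exp (-(ν * (K : ℝ) ^ 4 - (K : ℝ) ^ 2) * (t - a))
      + (c₁ / K + c₂) / (ν * (K : ℝ) ^ 2 - 1)) / q ^ k := by
  have hqk : 0 < q ^ k := pow_pos hq _
  have h := ks_farMode_weighted_le hu hu' hν hq hc₁ hc₂ hK hk bound hF h0 ht
  rw [le_div_iff₀ hqk, mul_comm]; exact h

end Literature.Analysis.ODE
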